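import Summits.CriticalPhenomena.PercolationContinuityZ3.Theorems.PercNearOneGluingNoHeavyQuantShapePieceBlob
import HarnessLib

/-!
# QUANT lane R8, T-DEC: THE PIECE BESIDE A BIG BLOB FOR EVERY SHAPE `lo < K ≤ 4lo` AND EVERY GATE — certified brick PD2x on the three shape boxes (census-1 gen 33)

builds on p205010 (kernel theorem, internal audit signed; external expert review pending)

Support file (`--supports stmt-CriticalPhenomena-4575`), QUANT lane seat prim-quant-census-1 (gen 33); memo
`run/shared/lean/prim/quant/prim-quant-census-1/g33/WIDE3-G33.md` §4.  Theorems only, standard axioms, no sorries.  This file: `pbA_PD2x`, `pbB_PD2x`, `pbC_PD2x`.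
THE RULE (memo §4; exact regression `g33/code/exp6_pieceblob_rule.py`, 0 failures on 13 shapes `lo < K ≤ 4lo`): per outer gate, the low atom `lo` of
`S(γ) ∗ blob_{lo+K}(g)` goes to `2lo+K` while `θ₁(ν(lo)+ν(2lo+K)) ≤ ν(2lo+K)` (`θ₁ = max(y, D/(lo+K))`, `D = T − 2lo`); otherwise the flow
SPLITS — `a(1−γ)g(lo+K−D)/D` saturates `2lo+K`, the overflow `a(1−γ)(D−(lo+K)g)/D` goes to the top; for `D ≥ lo+K` everything goes to the top.
Bricks (polynomial inequalities in `lo, K, γ, g, D` (and `y`/`x`), K-units `c = lo/K ∈ [1/4, 1]` split into the boxes `[1/4,1/3]`, `[1/3,1/2]`, `[1/2,1]`):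
PB1/PB2 (top capacity of the overflow: ρ / floor), PC1a–c / PC2a–c (split cost: ρ / floor regime, three budget sub-cases), PD1/PD2 (top capacity,
regime II), PE1/PE2 (top cost, regime II); the floor-regime bricks are certified at the floor bound `ȳ = (2lo+D)·x_max/T₀` (`…GD` / `…XD` for
`x_max = g` / `(lo+Kγ)/(lo+K)`) and transported to every `y ≤ ȳ` by monotonicity (`pb_glue_cap`, `pb_glue_cost`).  Certificates: Handelman products found
by kit (`g33/code/kitjob6`: scipy/HiGHS dual simplex for the support + exact rational repair), checked here by `linarith`.

HONEST STATUS.  Algebra only.  `SiblingStep`, `GluedDominatedMass`, `SDECConvClosed`, `FarTreeRow` OPEN; RATE class (log\*) / honest sentence of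
`run/shared/lean/prim/quant/README.md` unchanged.  [this work].  Nothing here is cited as a published result.  The gluing rows served
[cite: KozmaNitzan2024, Conjecture 3 (p. 15)]; product measure [cite: Grimmett1999, §1.3 p. 10].
-/

noncomputable section

open scoped BigOperators

namespace Summit.CriticalPhenomena.PercolationContinuityZ3.Theorems
namespace Quant
namespace LawDec

set_option maxRecDepth 8192 in
/-- **top capacity, floor part at the floor bound `x`, regime II**, `lo/K ∈ [1/4, 1/3]` — degree-3 Handelman certificate, 14 products (kit j298822). [this work] -/
theorem pbA_PD2x (lo K γ g x : ℝ) (hlo : 0 < lo)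
    (hK1 : 3 * lo ≤ K) (hK2 : K ≤ 4 * lo) (hγ : lo ≤ K * γ) (hγ1 : γ ≤ 1) (hbig : 2 * lo ≤ (lo + K) * g) (hg1 : g ≤ 1)
    (hDmaxB' : lo + K ≤ (K * γ - lo + (lo + K) * g)) (hx0 : 0 ≤ x) (hxg' : x ≤ g) (hxB' : (lo + K) * x ≤ lo + K * γ) :
    x * (((1 - γ) * (1 - g)) + (γ * g))
      ≤ (γ * g) := by
  have hK : 0 < K := lt_of_lt_of_le (by linarith) hK1
  have hA : 0 ≤ K * γ - lo := sub_nonneg.2 hγ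
  have hE : 0 ≤ 1 - γ := sub_nonneg.2 hγ1
  have hBig : 0 ≤ (lo + K) * g - 2 * lo := sub_nonneg.2 hbig
  have hEg : 0 ≤ 1 - g := sub_nonneg.2 hg1
  have hClo : 0 ≤ 4 * lo - K := by linarith [hK2]
  have hChi : 0 ≤ K - 3 * lo := by linarith [hK1]
  have hDmaxB : 0 ≤ (K * γ - lo + (lo + K) * g) - (lo + K) := sub_nonneg.2 hDmaxB'
  have hx0 : 0 ≤ x := hx0
  have hxg : 0 ≤ g - x := sub_nonneg.2 hxg'
  have hxB : 0 ≤ lo + K * γ - (lo + K) * x := sub_nonneg.2 hxB'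
  have key : 0 ≤ K * ((γ * g)
      - (x * (((1 - γ) * (1 - g)) + (γ * g)))) := by
    linarith [mul_nonneg hxg hDmaxB,
      mul_nonneg hxg hxB,
      mul_nonneg hx0 hxB,
      mul_nonneg (mul_nonneg hClo hx0) hxg,
      mul_nonneg (mul_nonneg hEg hxg) hxB,
      mul_nonneg (mul_nonneg hEg hx0) hDmaxB,
      mul_nonneg (mul_nonneg hEg hx0) hxB,
      mul_nonneg (mul_nonneg hEg hChi) hxg,
      mul_nonneg (mul_nonneg hEg hClo) hx0,
      mul_nonneg (mul_nonneg hBig hx0) hxg,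
      mul_nonneg (mul_nonneg (mul_nonneg hE hx0) hx0) hK.le,
      mul_nonneg hA hxg,
      mul_nonneg (mul_nonneg hA hxg) hxg,
      mul_nonneg (mul_nonneg hA hEg) hxg]
  by_contra hc; push Not at hc
  have := mul_neg_of_pos_of_neg hK (show (γ * g) - (x * (((1 - γ) * (1 - g)) + (γ * g))) < 0 by linarith)
  linarith

set_option maxRecDepth 8192 in
/-- **top capacity, floor part at the floor bound `x`, regime II**, `lo/K ∈ [1/3, 1/2]` — degree-3 Handelman certificate, 14 products (kit j298823). [this work] -/
theorem pbB_PD2x (lo K γ g x : ℝ) (hlo : 0 < lo)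
    (hK1 : 2 * lo ≤ K) (hK2 : K ≤ 3 * lo) (hγ : lo ≤ K * γ) (hγ1 : γ ≤ 1) (hbig : 2 * lo ≤ (lo + K) * g) (hg1 : g ≤ 1)
    (hDmaxB' : lo + K ≤ (K * γ - lo + (lo + K) * g)) (hx0 : 0 ≤ x) (hxg' : x ≤ g) (hxB' : (lo + K) * x ≤ lo + K * γ) :
    x * (((1 - γ) * (1 - g)) + (γ * g))
      ≤ (γ * g) := by
  have hK : 0 < K := lt_of_lt_of_le (by linarith) hK1
  have hA : 0 ≤ K * γ - lo := sub_nonneg.2 hγ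
  have hE : 0 ≤ 1 - γ := sub_nonneg.2 hγ1
  have hBig : 0 ≤ (lo + K) * g - 2 * lo := sub_nonneg.2 hbig
  have hEg : 0 ≤ 1 - g := sub_nonneg.2 hg1
  have hClo : 0 ≤ 3 * lo - K := by linarith [hK2]
  have hChi : 0 ≤ K - 2 * lo := by linarith [hK1]
  have hDmaxB : 0 ≤ (K * γ - lo + (lo + K) * g) - (lo + K) := sub_nonneg.2 hDmaxB'
  have hx0 : 0 ≤ x := hx0
  have hxg : 0 ≤ g - x := sub_nonneg.2 hxg'
  have hxB : 0 ≤ lo + K * γ - (lo + K) * x := sub_nonneg.2 hxB'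
  have key : 0 ≤ K * ((γ * g)
      - (x * (((1 - γ) * (1 - g)) + (γ * g)))) := by
    linarith [mul_nonneg hxg hDmaxB,
      mul_nonneg hxg hxB,
      mul_nonneg hx0 hxB,
      mul_nonneg (mul_nonneg hClo hx0) hxg,
      mul_nonneg (mul_nonneg hEg hxg) hxB,
      mul_nonneg (mul_nonneg hEg hx0) hDmaxB,
      mul_nonneg (mul_nonneg hEg hx0) hxB,
      mul_nonneg (mul_nonneg hEg hChi) hxg,
      mul_nonneg (mul_nonneg hEg hClo) hx0,
      mul_nonneg (mul_nonneg hBig hx0) hxg,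
      mul_nonneg (mul_nonneg (mul_nonneg hE hx0) hx0) hK.le,
      mul_nonneg hA hxg,
      mul_nonneg (mul_nonneg hA hxg) hxg,
      mul_nonneg (mul_nonneg hA hEg) hxg]
  by_contra hc; push Not at hc
  have := mul_neg_of_pos_of_neg hK (show (γ * g) - (x * (((1 - γ) * (1 - g)) + (γ * g))) < 0 by linarith)
  linarith

set_option maxRecDepth 8192 in
/-- **top capacity, floor part at the floor bound `x`, regime II**, `lo/K ∈ [1/2, 1]` — degree-3 Handelman certificate, 18 products (kit j298824). [this work] -/
theorem pbC_PD2x (lo K γ g x : ℝ) (hlo : 0 < lo)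
    (hK1 : lo ≤ K) (hK2 : K ≤ 2 * lo) (hγ : lo ≤ K * γ) (hγ1 : γ ≤ 1) (hbig : 2 * lo ≤ (lo + K) * g) (hg1 : g ≤ 1) (hDmaxB' : lo + K ≤ (K * γ - lo + (lo + K) * g))
    (hx0 : 0 ≤ x) (hxg' : x ≤ g) (hxB' : (lo + K) * x ≤ lo + K * γ) :
    x * (((1 - γ) * (1 - g)) + (γ * g))
      ≤ (γ * g) := by
  have hK : 0 < K := lt_of_lt_of_le (by linarith) hK1
  have hA : 0 ≤ K * γ - lo := sub_nonneg.2 hγ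
  have hE : 0 ≤ 1 - γ := sub_nonneg.2 hγ1
  have hBig : 0 ≤ (lo + K) * g - 2 * lo := sub_nonneg.2 hbig
  have hEg : 0 ≤ 1 - g := sub_nonneg.2 hg1
  have hClo : 0 ≤ 2 * lo - K := by linarith [hK2]
  have hChi : 0 ≤ K - lo := by linarith [hK1]
  have hDmaxB : 0 ≤ (K * γ - lo + (lo + K) * g) - (lo + K) := sub_nonneg.2 hDmaxB'
  have hx0 : 0 ≤ x := hx0
  have hxg : 0 ≤ g - x := sub_nonneg.2 hxg'
  have hxB : 0 ≤ lo + K * γ - (lo + K) * x := sub_nonneg.2 hxB'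
  have key : 0 ≤ K ^ 2 * ((γ * g)
      - (x * (((1 - γ) * (1 - g)) + (γ * g)))) := by
    linarith [mul_nonneg hxB hK.le,
      mul_nonneg hxB hDmaxB,
      mul_nonneg (mul_nonneg hxg hxB) hK.le,
      mul_nonneg (mul_nonneg hx0 hxB) hK.le,
      mul_nonneg (mul_nonneg hChi hxg) hDmaxB,
      mul_nonneg (mul_nonneg (mul_nonneg hClo hx0) hxg) hK.le,
      mul_nonneg (mul_nonneg (mul_nonneg hEg hx0) hDmaxB) hK.le,
      mul_nonneg (mul_nonneg (mul_nonneg hEg hx0) hxB) hK.le,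
      mul_nonneg (mul_nonneg hEg hChi) hDmaxB,
      mul_nonneg (mul_nonneg (mul_nonneg hEg hChi) hxg) hK.le,
      mul_nonneg (mul_nonneg hEg hClo) hK.le,
      mul_nonneg (mul_nonneg (mul_nonneg hEg hClo) hx0) hK.le,
      mul_nonneg (mul_nonneg (mul_nonneg hBig hx0) hxg) hK.le,
      mul_nonneg (mul_nonneg hE hDmaxB) hK.le,
      mul_nonneg (mul_nonneg (mul_nonneg (mul_nonneg hE hx0) hxg) hK.le) hK.le,
      mul_nonneg (mul_nonneg (mul_nonneg (mul_nonneg hE hx0) hx0) hK.le) hK.le,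
      mul_nonneg (mul_nonneg (mul_nonneg (mul_nonneg hE hEg) hEg) hK.le) hK.le,
      mul_nonneg (mul_nonneg (mul_nonneg hA hxg) hxg) hK.le]
  by_contra hc; push Not at hc
  have := mul_neg_of_pos_of_neg (pow_pos hK 2) (show (γ * g) - (x * (((1 - γ) * (1 - g)) + (γ * g))) < 0 by linarith)
  linarith

end LawDec
end Quant
end Summit.CriticalPhenomena.PercolationContinuityZ3.Theorems
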